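import Summits.CriticalPhenomena.PercolationContinuityZ3.Theses.PercNearOneGluing
import Literature.Probability.Percolation.PercolationProofs
import Literature.Probability.Percolation.ConditionalPositiveAssociationProofs
import Literature.Probability.Percolation.TwoClusterConditionalAssociationProofs
import Summits.CriticalPhenomena.PercolationContinuityZ3.Theorems.PercNearOneGluingAdditiveGluingGoodBase
import Summits.CriticalPhenomena.PercolationContinuityZ3.Theorems.PercNearOneGluingAdditiveGluingGoodTwoRelays
import Summits.CriticalPhenomena.PercolationContinuityZ3.Theorems.PercNearOneGluingAdditiveGluingLemma5AnyRelay
import Summits.CriticalPhenomena.PercolationContinuityZ3.Theorems.PercNearOneGluingAdditiveGluingGoodStep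

/-! TTRL-lite variant V23 of stmt-CriticalPhenomena-4576 -/

namespace Summit.CriticalPhenomena.PercolationContinuityZ3.Theorems

open MeasureTheory Literature.Probability.LatticeModels Literature.Probability.Percolation
open scoped Classical BigOperators

/-- TTRL-lite variant V23 (small case `n ≤ 2`) of the additive gluing bound
(stmt-CriticalPhenomena-4576): on at most two vertices every relay `a ∈ A` is `o` itself
(then the hypothesis at `a = o` and `μ.real ≤ 1` suffice) or equals `b` / `o = b`
(then the union is contained in `{o ↔ b}` by reflexivity of reachability). -/
theorem AdditiveGluing_var23 :
    ∀ (n : ℕ) (w : Sym2 (Fin n) → unitInterval) (A : Finset (Fin n)) (o b : Fin n) (t : ℝ),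
      n ≤ 2 → 0 ≤ t →
      (∀ a ∈ A, 1 - t ≤ (Literature.Probability.LatticeModels.prodBernoulli w).real
        (Literature.Probability.Percolation.openConn a b)) →
      (Literature.Probability.LatticeModels.prodBernoulli w).real
          (⋃ a ∈ A, Literature.Probability.Percolation.openConn o a) - t ≤
        (Literature.Probability.LatticeModels.prodBernoulli w).real
          (Literature.Probability.Percolation.openConn o b) := by
  intro n w A o b t hn ht hA
  by_cases ho : o ∈ A
  · have h1 := hA o ho
    have h2 : (prodBernoulli w).real (⋃ a ∈ A, openConn o a) ≤ 1 := measureReal_le_one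
    linarith
  · have hsub : (⋃ a ∈ A, openConn o a) ⊆ openConn o b := by
      intro ω hω
      simp only [Set.mem_iUnion] at hω
      obtain ⟨a, ha, hωa⟩ := hω
      have hao : a ≠ o := fun h => ho (h ▸ ha)
      by_cases hbo : b = o
      · subst hbo
        exact SimpleGraph.Reachable.refl _
      · have hab : a = b := by
          apply Fin.ext
          have h3 : a.val ≠ o.val := fun h => hao (Fin.ext h)
          have h4 : b.val ≠ o.val := fun h => hbo (Fin.ext h)
          have := a.isLt
          have := b.isLt
          have := o.isLt
          omega
        rw [← hab]
        exact hωa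
    have hmono : (prodBernoulli w).real (⋃ a ∈ A, openConn o a) ≤
        (prodBernoulli w).real (openConn o b) :=
      measureReal_mono hsub
    linarith

end Summit.CriticalPhenomena.PercolationContinuityZ3.Theorems
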